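import Mathlib.Analysis.InnerProductSpace.Spectrum
import Mathlib.Analysis.InnerProductSpace.Adjoint
import HarnessLib

/-!
# The inverse square root of a positive self-adjoint operator (topic `Analysis/PDE`)

Layer (III), step 2a, of the programme to prove short-time existence for quasilinear strictly
parabolic systems on a closed manifold (hypothesis `hQL` of
`Literature.Geometry.Riemannian.ricciFlow_shortTime_existence_of_quasilinear`). The framed
charts of the adapted patch system normalise the principal symbol of the linearisation to the
identity at the chart centres: the frame is `N ∘ A₀` with `N = S₀^{-1/2}`, `S₀` the (symmetric,
positive definite) symbol operator at the centre in a fixed frame `A₀`. This file constructs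
`N` on a finite-dimensional real inner product space by the spectral theorem
(`LinearMap.IsSymmetric.eigenvectorBasis`):

* `exists_invSqrt` — for a self-adjoint `S` with `⟪S ξ, ξ⟫ > 0` for `ξ ≠ 0` there is a
  self-adjoint continuous linear isomorphism `N` with `N ∘ S ∘ N = 1`.

Everything is proved; no named fact and no `sorry` is introduced.

## References

* T. Kato, *Perturbation Theory for Linear Operators*, Springer 1966, Ch. I, §6.9 and Ch. V,
  §3.11 (square roots of positive operators). [Kato1966]
-/

noncomputable section

open InnerProductSpace
open scoped RealInnerProductSpace

namespace Literature.Analysis.PDE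

variable {F : Type*} [NormedAddCommGroup F] [InnerProductSpace ℝ F] [FiniteDimensional ℝ F]

/-- **Diagonal operators in an orthonormal basis**: `D_c ξ = Σ_k c_k ⟪w_k, ξ⟫ w_k`. [folklore] -/
def diagOp {n : ℕ} (w : OrthonormalBasis (Fin n) ℝ F) (c : Fin n → ℝ) : F →L[ℝ] F :=
  ∑ k, c k • (innerSL ℝ (w k)).smulRight (w k)

omit [FiniteDimensional ℝ F] in
/-- `diagOp_apply`: `D_c ξ = Σ_k c_k ⟪w_k, ξ⟫ w_k`. [folklore] -/
theorem diagOp_apply {n : ℕ} (w : OrthonormalBasis (Fin n) ℝ F) (c : Fin n → ℝ) (ξ : F) :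
    diagOp w c ξ = ∑ k, c k • (⟪w k, ξ⟫ • w k) := by
  simp only [diagOp, FunLike.coe_sum, Finset.sum_apply, FunLike.coe_smul, Pi.smul_apply, ContinuousLinearMap.smulRight_apply,
    innerSL_apply_apply]

omit [FiniteDimensional ℝ F] in
/-- Diagonal operators act on basis vectors by their entries. [folklore] -/
theorem diagOp_basis {n : ℕ} (w : OrthonormalBasis (Fin n) ℝ F) (c : Fin n → ℝ) (k : Fin n) : diagOp w c (w k) = c k • w k := by
  rw [diagOp_apply, Finset.sum_eq_single k]
  · rw [w.orthonormal.1 k |> fun h ↦ show ⟪w k, w k⟫ = 1 by rw [real_inner_self_eq_norm_sq, h, one_pow], one_smul]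
  · intro j _ hjk
    rw [show ⟪w j, w k⟫ = 0 from w.orthonormal.2 hjk, zero_smul, smul_zero]
  · intro hk; exact absurd (Finset.mem_univ k) hk

omit [FiniteDimensional ℝ F] in
/-- Two continuous linear maps agreeing on an orthonormal basis are equal. [folklore] -/
theorem clm_eq_of_basis {n : ℕ} (w : OrthonormalBasis (Fin n) ℝ F) {A B : F →L[ℝ] F} (h : ∀ k, A (w k) = B (w k)) : A = B := by
  refine ContinuousLinearMap.ext fun ξ ↦ ?_
  conv_lhs => rw [← w.sum_repr' ξ]
  conv_rhs => rw [← w.sum_repr' ξ]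
  simp only [map_sum, map_smul, h]

omit [FiniteDimensional ℝ F] in
/-- Diagonal operators compose entrywise. [folklore] -/
theorem diagOp_comp {n : ℕ} (w : OrthonormalBasis (Fin n) ℝ F) (c d : Fin n → ℝ) :
    diagOp w c ∘L diagOp w d = diagOp w (fun k ↦ c k * d k) := by
  refine clm_eq_of_basis w fun k ↦ ?_
  simp only [ContinuousLinearMap.coe_comp, Function.comp_apply, diagOp_basis, map_smul, smul_smul, mul_comm]

omit [FiniteDimensional ℝ F] in
/-- The diagonal operator with unit entries is the identity. [folklore] -/
theorem diagOp_one {n : ℕ} (w : OrthonormalBasis (Fin n) ℝ F) : diagOp w (fun _ ↦ (1 : ℝ)) = 1 :=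
  clm_eq_of_basis w fun k ↦ by rw [diagOp_basis, one_smul]; rfl

omit [FiniteDimensional ℝ F] in
/-- Diagonal operators are self-adjoint: `⟪D ξ, ζ⟫ = ⟪ξ, D ζ⟫`. [folklore] -/
theorem inner_diagOp_comm {n : ℕ} (w : OrthonormalBasis (Fin n) ℝ F) (c : Fin n → ℝ) (ξ ζ : F) :
    ⟪diagOp w c ξ, ζ⟫ = ⟪ξ, diagOp w c ζ⟫ := by
  simp only [diagOp_apply, sum_inner, inner_sum, real_inner_smul_left, real_inner_smul_right]
  refine Finset.sum_congr rfl fun k _ ↦ ?_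
  rw [real_inner_comm (w k) ξ]
  ring

/-- **The inverse square root of a positive self-adjoint operator.** On a finite-dimensional
real inner product space, for a self-adjoint `S` with `⟪S ξ, ξ⟫ > 0` for all `ξ ≠ 0` there is a
continuous linear isomorphism `N`, self-adjoint (`⟪N ξ, ζ⟫ = ⟪ξ, N ζ⟫`), with `N ∘ S ∘ N = 1`.
[cite: Kato1966, Ch. V, §3.11] -/
theorem exists_invSqrt {S : F →L[ℝ] F} (hS : ∀ ξ ζ : F, ⟪S ξ, ζ⟫ = ⟪ξ, S ζ⟫) (hpos : ∀ ξ : F, ξ ≠ 0 → 0 < ⟪S ξ, ξ⟫) :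
    ∃ N : F ≃L[ℝ] F, (∀ ξ ζ : F, ⟪(N : F →L[ℝ] F) ξ, ζ⟫ = ⟪ξ, (N : F →L[ℝ] F) ζ⟫) ∧
      (N : F →L[ℝ] F) ∘L S ∘L (N : F →L[ℝ] F) = 1 := by
  -- the spectral decomposition of `S`
  have hsym : (S : F →ₗ[ℝ] F).IsSymmetric := fun ξ ζ ↦ hS ξ ζ
  set n := Module.finrank ℝ F with hn
  set w : OrthonormalBasis (Fin n) ℝ F := hsym.eigenvectorBasis rfl with hw
  set μ : Fin n → ℝ := hsym.eigenvalues rfl with hμ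
  have hSw : ∀ k, S (w k) = μ k • w k := fun k ↦ hsym.apply_eigenvectorBasis rfl k
  have hμpos : ∀ k, 0 < μ k := by
    intro k
    have hne : w k ≠ 0 := w.orthonormal.ne_zero k
    have h := hpos (w k) hne
    rw [hSw k, real_inner_smul_left, real_inner_self_eq_norm_sq, w.orthonormal.1 k, one_pow, mul_one] at h
    exact h
  -- `S` is the diagonal operator of its eigenvalues
  have hSdiag : S = diagOp w μ := clm_eq_of_basis w fun k ↦ by rw [hSw, diagOp_basis]
  -- `N = diag(μ^{-1/2})`, with inverse `diag(μ^{1/2})`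
  set c : Fin n → ℝ := fun k ↦ (Real.sqrt (μ k))⁻¹ with hc
  set c' : Fin n → ℝ := fun k ↦ Real.sqrt (μ k) with hc'
  have hcc' : ∀ k, c k * c' k = 1 := fun k ↦ inv_mul_cancel₀ (Real.sqrt_pos.2 (hμpos k)).ne'
  have h1 : diagOp w c ∘L diagOp w c' = 1 := by
    rw [diagOp_comp, ← diagOp_one w]; congr 1; funext k; exact hcc' k
  have h2 : diagOp w c' ∘L diagOp w c = 1 := by
    rw [diagOp_comp, ← diagOp_one w]; congr 1; funext k; rw [mul_comm]; exact hcc' k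
  set N : F ≃L[ℝ] F := ContinuousLinearEquiv.equivOfInverse (diagOp w c) (diagOp w c')
    (fun ξ ↦ by have := congrArg (fun T : F →L[ℝ] F ↦ T ξ) h2; simpa using this)
    (fun ξ ↦ by have := congrArg (fun T : F →L[ℝ] F ↦ T ξ) h1; simpa using this) with hN
  have hNc : (N : F →L[ℝ] F) = diagOp w c := rfl
  refine ⟨N, fun ξ ζ ↦ by rw [hNc]; exact inner_diagOp_comm w c ξ ζ, ?_⟩
  rw [hNc, hSdiag, diagOp_comp, diagOp_comp, ← diagOp_one w]
  congr 1
  funext k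
  show c k * (μ k * c k) = 1
  have hsq : Real.sqrt (μ k) * Real.sqrt (μ k) = μ k := Real.mul_self_sqrt (hμpos k).le
  rw [show c k = (Real.sqrt (μ k))⁻¹ from rfl, mul_comm (μ k), ← mul_assoc, ← mul_inv, hsq]
  exact inv_mul_cancel₀ (hμpos k).ne'

end Literature.Analysis.PDE
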